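import Summits.BirchSwinnertonDyer.BirchSwinnertonDyer.Theorems.AdditiveBranchIMCMultLowerRegulatorRigidity
import Summits.BirchSwinnertonDyer.BirchSwinnertonDyer.Theorems.AdditiveBranchIMCMultLowerOfParts
import Summits.BirchSwinnertonDyer.Rank1Residual.AdditivePotMult.PotMultBranchPAdicGrossZagierIffRouteG
import Summits.BirchSwinnertonDyer.Rank1Residual.AdditivePotMult.X3MBranchPAdicGrossZagier
import HarnessLib

/-!
# Route `AdditiveBranchIMC` (rung K1), crux `MultLower` (item `stmt-BirchSwinnertonDyer-19359`), cell (M),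
# rank 1: the child `MultSchneiderNondegeneracy` (item 19591) from the (M) CLASS CERTIFICATE, the §C v3
# GLUE, and the per-pair doors that the ∀-datum `p`-adic Gross–Zagier now opens

Cell `bsd-addord`, seat `bsd-addord-k1-c4` (gen 4). Sequel of `…MultLowerRegulatorRigidity.lean` (this seat,
REGULATOR RIGIDITY + item 19592 BY NAME modulo hFact / hDelM / GZK). THEOREMS ONLY (no definition, no named
fact, no `sorry`); every published input is an explicit named-fact binder; the (M) class certificate is an
explicit census-literal binder (the cell's standing shape, `PotMultBranchPAdicGrossZagierIffRouteG` §1);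
nothing is asserted about any curve; cell (M) stays CONSTRUCTION-shaped; nothing booked.

## What

* §1 `schneiderConjecture_of_twisted_of_multCoeffOneNeZero` — the (M) twin of gz's
  `schneiderConjecture_of_twisted_of_branchCoeffOneNeZero`: for a datum `Dh` carrying hFact's clauses
  (`TwistedBranchGrossZagierAt W p Dh`) and a MULTIPLICATIVE twist model `C • V^{(p*)} = W`, the census bit
  `[T¹](ϖ·L^±_p(f_V, a_p(V), ω^{(p−1)/2}, T)) ≠ 0` (= `A′ ≠ 0`) gives `Reg_p(E,Dh) ≠ 0`
  (`ϖ·[T¹]B·log_p γ = u·q·Reg_p`, `log_p γ ≠ 0`).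
* §2 `potMult_forall_schneider_of_delbourgoDatumFact_of_multCoeffOneNeZero`: on `PotMult W p`, `r_an = 1`,
  Schneider for EVERY (B)-datum from hFact's datum (§1) by REGULATOR RIGIDITY — NO image / surjectivity /
  Kato hypothesis (compare `ClassX4M.forall_schneider_of_katoHalf_of_multCoeffOneNeZero`, which needs Kato's
  half and `Surj`, and `ClassX3M.…_of_wuthrichHalf_…`).
* §3 **ITEM 19591 `MultSchneiderNondegeneracy` BY NAME** ⟸ hFact + `Delbourgo2002.mainTheorem_potMult` + GZK
  + `hmodD` + the (M) CLASS CERTIFICATE `hCert` (the bit at every rank-1 pair of cell (M); per pair ONE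
  modular-symbol / Riemann-sum number, the cell's two-engine A′ certificates; as a ∀-statement it is
  Schneider's conjecture on (M) in certificate form — H3 of the cell, the (G-ord) shape
  `GordTwoRankOneClassCert` of item 19499).
* §4 **§C v3 GLUE** `multLower_of_facts_of_delbourgoDatumFact_of_multLambdaLower_of_classCert :
  DelbourgoPotMultUnit → PalQuadraticTwistPeriod → DelbourgoLeadingTermPotMult → MultModularityInputs →
  hFact → MultLambdaLower → (M) class certificate → MultLower` — the two ∀-datum cruxes 19591/19592 of the
  v2 split REPLACED by ONE by-name published input (hFact) and ONE certificate-shaped child; composition =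
  p437547 `multLowerOfParts_proof` over §3 and `multBranchPAdicGrossZagierAt_of_delbourgoDatumFact`.
* §5 PER PAIR (booking doors opened by the ∀-datum (M) `p`-adic Gross–Zagier):
  `potMult_missingLowerBoundAt_rankOne_of_delbourgoDatumFact_of_quadraticBranchLower_of_multCoeffOneNeZero`
  (any (M) row incl. X3♯(M) and the non-surjective rows: facts + p10's Λ-adic input on the twist models +
  the bit ⟹ LOWER half); `ClassX4M.bsdp_rankOne_of_delbourgoDatumFact_of_katoHalf_of_firstUnitIndex_of_budget`
  (X4(M) ∧ surj, the index-`n₀` rows of Route G: hFact + Kato's half + record at `n₀` + budget + bit ⟹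
  **`BSD(E,p)`** — n1011-p07's capstone iff `.mpr` fed by the ∀-datum `p`-adic GZ; the first (M) rank-1 door
  whose analytic input is a by-name fact rather than the typed `BranchPAdicGrossZagierMultAt`);
  `ClassX3M.bsdp_rankOne_of_delbourgoDatumFact_of_wuthrichHalf_of_quadraticBranchLower_of_multCoeffOneNeZero`
  (X3♯(M): hFact + Wuthrich's half + Λ-adic input + bit ⟹ `BSD(E,p)`).

HONEST LABELS: conditional helper theorems; hFact is a named fact (cell theorem PROOF-gz, REF-gz PASS with
GZ-H — binding on every (M) statement here, which cover `V` SPLIT multiplicative: the height identification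
behind hFact's Gross–Zagier half is the (n-exc)-conditional printed sentence Disegni 2017 Rem. 1.3.2 +
Disegni 2022 Thm. B context, (n-exc) discharged by `ε_p` ramified; NOT Delbourgo 2002 p. 62; Nekovář 1993
§7.14 unheld, acq-10827); `QuadraticBranchLowerDivisibilityAt` at a multiplicative `V` (item 19590) is NOT
in print; the class certificate is per-pair EVIDENCE, never a theorem class-wide. Nothing booked.

References: Delbourgo, J. Number Theory 95 (2002) Thm. (A), (B) [Delbourgo2002]; Disegni, Compos. Math. 153
(2017) Thm. B, Rem. 1.3.2 [Disegni2017]; Kato, Astérisque 295 (2004) Thm. 17.4 (3) [Kato2004Asterisque];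
Wuthrich, Doc. Math. 19 (2014) Thm. 16 [Wuthrich2014]; Mazur–Tate–Teitelbaum 1986 §I.10, §I.13–I.14
[MazurTateTeitelbaum1986Invent]; Schneider, Invent. Math. 79 (1985) [Schneider1985]; Miller 2011 Def. 1.1
[Miller2011LMS].
-/

set_option autoImplicit false
set_option linter.dupNamespace false

noncomputable section

open scoped Classical MatrixGroups ModularForm

namespace Summit.BirchSwinnertonDyer.BirchSwinnertonDyer.Theorems.AdditiveBranchIMCMultLower

open CongruenceSubgroup WeierstrassCurve Literature.NumberTheory.EllipticCurves
  Literature.NumberTheory.EllipticCurves.ModularForms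
  Literature.NumberTheory.EllipticCurves.Rank1Residual
  Literature.NumberTheory.EllipticCurves.Rank1Residual.Typed
  Literature.NumberTheory.EllipticCurves.Delbourgo2002
  Literature.NumberTheory.EllipticCurves.Disegni2017
  Summit.BirchSwinnertonDyer.Rank1Residual.Additive
  Summit.BirchSwinnertonDyer.Rank1Residual.AdditivePotMult
  Summit.BirchSwinnertonDyer.BirchSwinnertonDyer.Theses.AdditiveBranchIMC

variable {W : WeierstrassCurve ℚ} {p : ℕ} [hp : Fact p.Prime]

/-! ### §1 Schneider for hFact's datum on (M) from the census bit `[T¹](ϖ·B) ≠ 0` -/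

/-- **Schneider for the fact's datum from one analytic number, (M) twin.** For `W` of analytic rank one, a
datum `Dh` carrying the twisted-branch Gross–Zagier clauses (`TwistedBranchGrossZagierAt W p Dh`) and a
MULTIPLICATIVE twist model `C • V^{(p*)} = W`: if on every twist datum of `W` the Néron-normalised one-term
branch `ϖ·L^±_p(f_V, a_p(V), ω^{(p−1)/2}, T)` has NON-ZERO linear coefficient (the census's `A′ ≠ 0`, the
census-literal bit `hne` of `PotMultBranchPAdicGrossZagierIffRouteG` §1), then `Reg_p(E,Dh) ≠ 0` —
`ϖ·[T¹]B·log_p γ = u·q·Reg_p(E,Dh)` (the (M) clause, `a_p(V) = V.LFunction p`) with `ϖ·[T¹]B ≠ 0`,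
`log_p γ ≠ 0`. GZ-H applies (module docstring). [cite: Disegni2017, Thm. B (§1.3.2), Rem. 1.3.2 (provenance of the clause)]
[cite: Delbourgo1998, §2.5 BS-D(p) (i), (ii) (pp. 151–152)] [cite: MazurTateTeitelbaum1986Invent, §I.10, §I.13–I.14] -/
theorem schneiderConjecture_of_twisted_of_multCoeffOneNeZero [W.IsElliptic] [W.IsGloballyMinimal]
    (hp2 : p ≠ 2) (hmodD : nonempty_modularParametrizationData)
    (hr : W.analyticRank = 1) {Dh : PAdicHeightData W p} (hTw : TwistedBranchGrossZagierAt W p Dh)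
    (hne : ∀ (V : WeierstrassCurve ℚ) [V.IsElliptic] [V.IsGloballyMinimal] (C : VariableChange ℚ),
      Mult V p → C • V.quadraticTwist ((-1 : ℚ) ^ (p / 2) * p) = W →
      ∀ {N : ℕ} [NeZero N] (f : CuspForm (Gamma0 N) 2), IsNewformOf V f → ∀ (ap : ℤ), cuspCoeff f p = ap →
      ∀ ϖ : ℚ, (if Even (p / 2) then (ϖ : ℝ) * V.realPeriodRat = plusPeriod f
          else (ϖ : ℝ) * V.imaginaryPeriodRat = minusPeriod f) →
        PowerSeries.coeff 1 (PowerSeries.C (ϖ : ℚ_[p]) *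
            (if Even (p / 2) then padicLFunctionPlusBranchMult f (ap : ℚ_[p]) (p / 2)
              else padicLFunctionMinusBranchMult f (ap : ℚ_[p]) (p / 2))) ≠ 0)
    (V : WeierstrassCurve ℚ) [V.IsElliptic] [V.IsGloballyMinimal]
    (C : VariableChange ℚ) (hV : Mult V p) (hC : C • V.quadraticTwist ((-1 : ℚ) ^ (p / 2) * p) = W) :
    SchneiderConjecture Dh := by
  have hodd : p % 4 = 1 ∨ p % 4 = 3 := by
    obtain ⟨k, hk⟩ := hp.out.odd_of_ne_two hp2
    omega
  haveI : NeZero (V.conductorNorm ℤ) := ⟨(V.conductorNorm_pos_holds).ne'⟩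
  obtain ⟨Dm⟩ := hmodD V
  obtain ⟨ϖ, hϖ⟩ := exists_periodRatio_parity (p := p) V Dm
  have h1 := hne V C hV hC Dm.f Dm.isNewformOf (V.LFunction p) (Dm.isNewformOf.2 p) ϖ hϖ
  obtain ⟨q, -, heven, hoddc⟩ := hTw hr V Dm.f (Or.inr hV) Dm.isNewformOf
  rw [SchneiderConjecture]
  rcases hodd with h1' | h3
  · have hev : Even (p / 2) := ⟨p / 4, by omega⟩
    rw [if_pos hev] at hϖ h1
    have hC' : C • V.quadraticTwist (p : ℚ) = W := by
      rw [pStar_eq_of_mod_four p (Or.inl h1'), if_pos h1'] at hC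
      exact hC
    obtain ⟨u, hu⟩ := (heven C ϖ h1' hC' hϖ).2 hV
    rw [PowerSeries.coeff_C_mul] at h1
    exact padicRegulator_ne_zero_of_twisted_identity hp2 h1 hu
  · have hne' : ¬ Even (p / 2) := by
      rw [Nat.not_even_iff_odd]
      exact ⟨p / 4, by omega⟩
    rw [if_neg hne'] at hϖ h1
    have hC' : C • V.quadraticTwist (-(p : ℚ)) = W := by
      rw [pStar_eq_of_mod_four p (Or.inr h3), if_neg (by omega)] at hC
      exact hC
    obtain ⟨u, hu⟩ := (hoddc C ϖ h3 hC' hϖ).2 hV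
    rw [PowerSeries.coeff_C_mul] at h1
    exact padicRegulator_ne_zero_of_twisted_identity hp2 h1 hu

/-! ### §2 (M): Schneider for EVERY (B)-datum from hFact's datum and the bit, by rigidity -/

/-- **(M), `r_an = 1`: Schneider for EVERY (B)-datum from the census bit — NO image hypothesis.** For `W`
globally minimal, `p` odd, `PotMult W p`, `r_an = 1`: hFact supplies `Dh₀` with Delbourgo's clauses and the
twisted Gross–Zagier clauses; the bit gives `Reg_p(E,Dh₀) ≠ 0` (§1, at the multiplicative `p*`-twist model
`PotMult.exists_mult_pStar_twist_model`); REGULATOR RIGIDITY (`schneiderConjecture_of_leadingTermClauses_of_one_datum`,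
(A) from `hDelM`, `Ш` finite from GZK, `ℓ_p = 1`) transports it to every datum `Dh` with Delbourgo's clauses.
GZ-H applies. [cite: Disegni2017, Thm. B (§1.3.2), Rem. 1.3.2] [cite: Delbourgo2002, Theorem (A), (B) (p. 40)]
[cite: Schneider1985, Thm. 2′ (shape; nothing asserted)] -/
theorem potMult_forall_schneider_of_delbourgoDatumFact_of_multCoeffOneNeZero
    [W.IsElliptic] [W.IsGloballyMinimal]
    (hFact : delbourgoDatum_rankOne_leadingTerms) (hDelM : Delbourgo2002.mainTheorem_potMult)
    (hGZK : rank_eq_analyticRank_of_analyticRank_le_one) (hmodD : nonempty_modularParametrizationData)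
    (hpm : Summit.BirchSwinnertonDyer.Rank1Residual.AdditivePotMult.PotMult W p) (hp2 : p ≠ 2) (hr : W.analyticRank = 1)
    (hne : ∀ (V : WeierstrassCurve ℚ) [V.IsElliptic] [V.IsGloballyMinimal] (C : VariableChange ℚ),
      Mult V p → C • V.quadraticTwist ((-1 : ℚ) ^ (p / 2) * p) = W →
      ∀ {N : ℕ} [NeZero N] (f : CuspForm (Gamma0 N) 2), IsNewformOf V f → ∀ (ap : ℤ), cuspCoeff f p = ap →
      ∀ ϖ : ℚ, (if Even (p / 2) then (ϖ : ℝ) * V.realPeriodRat = plusPeriod f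
          else (ϖ : ℝ) * V.imaginaryPeriodRat = minusPeriod f) →
        PowerSeries.coeff 1 (PowerSeries.C (ϖ : ℚ_[p]) *
            (if Even (p / 2) then padicLFunctionPlusBranchMult f (ap : ℚ_[p]) (p / 2)
              else padicLFunctionMinusBranchMult f (ap : ℚ_[p]) (p / 2))) ≠ 0)
    (Dh : PAdicHeightData W p) (hB : LeadingTermClauses W p Dh) : SchneiderConjecture Dh := by
  obtain ⟨Dh₀, hB₀, hTw₀⟩ := hFact W p hp2 hpm.not_hasCM hpm.1 hr
    (delbourgo2002PrintedHypotheses_of_potMult hpm.2 (hpm.exists_quadraticTwist_mult hp2))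
  obtain ⟨V, iV, iVm, C, hV, hC⟩ := hpm.exists_mult_pStar_twist_model hp2
  have hS₀ : SchneiderConjecture Dh₀ :=
    schneiderConjecture_of_twisted_of_multCoeffOneNeZero hp2 hmodD hr hTw₀ hne V C hV hC
  haveI : Finite W.sha := (hGZK W (by rw [hr])).2
  have hfin : Finite (AddCommGroup.primaryComponent W.sha p) := inferInstance
  exact schneiderConjecture_of_leadingTermClauses_of_one_datum (hpm.delbourgo2002 hDelM hp2).1 hfin
    hpm.reductionNonAnomalous hB₀ hB hS₀

/-! ### §3 ITEM 19591 `MultSchneiderNondegeneracy` BY NAME from the facts and the (M) class certificate -/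

/-- **ITEM 19591 `MultSchneiderNondegeneracy` BY NAME** ⟸ hFact `Disegni2017.delbourgoDatum_rankOne_leadingTerms`,
`Delbourgo2002.mainTheorem_potMult`, GZK, `hmodD` (PUBLISHED / cell fact, by name) and the (M) CLASS
CERTIFICATE `hCert`: at every pair of cell (M) of analytic rank `1`, on every multiplicative twist datum
`(V, C, f, a_p, ϖ)`, the linear coefficient of `ϖ·L^±_p(f, a_p, ω^{(p−1)/2}, T)` is non-zero (`A′ ≠ 0`; per
pair ONE `p`-adic number — the cell's two-engine certificates; class-wide it is Schneider's conjecture on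
(M) in certificate form, cell hazard H3). NO image / surjectivity / Kato hypothesis; `p = 3` included.
Conditional; nothing booked. [cite: Disegni2017, Thm. B (§1.3.2), Rem. 1.3.2]
[cite: Delbourgo2002, Theorem (A), (B) (p. 40)] [cite: Schneider1985, Thm. 2′ (shape; nothing asserted)] -/
theorem multSchneiderNondegeneracy_of_delbourgoDatumFact_of_classCert
    (hFact : delbourgoDatum_rankOne_leadingTerms) (hDelM : Delbourgo2002.mainTheorem_potMult)
    (hGZK : rank_eq_analyticRank_of_analyticRank_le_one) (hmodD : nonempty_modularParametrizationData)
    (hCert : ∀ (W : WeierstrassCurve ℚ) [W.IsElliptic] [W.IsGloballyMinimal] (p : ℕ) [Fact p.Prime],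
      N10.CellM W p → W.analyticRank = 1 →
      ∀ (V : WeierstrassCurve ℚ) [V.IsElliptic] [V.IsGloballyMinimal] (C : VariableChange ℚ),
        Mult V p → C • V.quadraticTwist ((-1 : ℚ) ^ (p / 2) * p) = W →
        ∀ {N : ℕ} [NeZero N] (f : CuspForm (Gamma0 N) 2), IsNewformOf V f → ∀ (ap : ℤ), cuspCoeff f p = ap →
        ∀ ϖ : ℚ, (if Even (p / 2) then (ϖ : ℝ) * V.realPeriodRat = plusPeriod f
            else (ϖ : ℝ) * V.imaginaryPeriodRat = minusPeriod f) →
          PowerSeries.coeff 1 (PowerSeries.C (ϖ : ℚ_[p]) *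
              (if Even (p / 2) then padicLFunctionPlusBranchMult f (ap : ℚ_[p]) (p / 2)
                else padicLFunctionMinusBranchMult f (ap : ℚ_[p]) (p / 2))) ≠ 0) :
    MultSchneiderNondegeneracy := by
  intro W _ _ p _ hcM hr Dh hB
  have hpm : Summit.BirchSwinnertonDyer.Rank1Residual.AdditivePotMult.PotMult W p := ⟨hcM.2.1, hcM.2.2⟩
  exact potMult_forall_schneider_of_delbourgoDatumFact_of_multCoeffOneNeZero hFact hDelM hGZK hmodD hpm
    hcM.1 hr (hCert W p hcM hr) Dh hB

/-! ### §4 The §C v3 GLUE: `MultLower` from the four held leaves, hFact, `MultLambdaLower` and the class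
certificate -/

/-- **§C v3 GLUE for crux 19359.** `MultLower` BY NAME from: the four HELD leaves of the v2 split
(`DelbourgoPotMultUnit` 19586, `PalQuadraticTwistPeriod` 19587, `DelbourgoLeadingTermPotMult` 19588,
`MultModularityInputs` 19589 = GZK ∧ modularity ∧ `hmodD`), ONE more by-name published input — hFact
`Disegni2017.delbourgoDatum_rankOne_leadingTerms` (twisted-branch `p`-adic Gross–Zagier for Delbourgo's
datum; PROOF-gz Thm. 1, REF-gz PASS with GZ-H) —, the Λ-adic content crux `MultLambdaLower` (19590,
verbatim) and the (M) CLASS CERTIFICATE (the bit at every rank-1 (M) pair). The v2 children 19591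
(`MultSchneiderNondegeneracy`) and 19592 (`MultBranchPAdicGrossZagierAt`) are DERIVED (§3 and
`multBranchPAdicGrossZagierAt_of_delbourgoDatumFact`) and fed to the landed v2 glue `multLowerOfParts_proof`
(p437547). So the crux reads: four published leaves + hFact + ONE Λ-adic conjecture + ONE certificate-shaped
child — the (G-ord) shape of crux 19358 (`GordTwoRankOneOfParts`). Conditional; nothing booked.
[cite: Delbourgo1998, Prop. 4, §2.2 Lemma (ii), Main Conjecture (p. 151) (shape)] [cite: Delbourgo2002, Theorem (A), (B) (p. 40)]
[cite: Disegni2017, Thm. B (§1.3.2), Rem. 1.3.2] [cite: Pal2012, Thm. 3.2] [cite: Miller2011LMS, Def. 1.1] -/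
theorem multLower_of_facts_of_delbourgoDatumFact_of_multLambdaLower_of_classCert
    (h1 : DelbourgoPotMultUnit) (h2 : PalQuadraticTwistPeriod) (h3 : DelbourgoLeadingTermPotMult)
    (h4 : MultModularityInputs) (hFact : delbourgoDatum_rankOne_leadingTerms) (hΛ : MultLambdaLower)
    (hCert : ∀ (W : WeierstrassCurve ℚ) [W.IsElliptic] [W.IsGloballyMinimal] (p : ℕ) [Fact p.Prime],
      N10.CellM W p → W.analyticRank = 1 →
      ∀ (V : WeierstrassCurve ℚ) [V.IsElliptic] [V.IsGloballyMinimal] (C : VariableChange ℚ),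
        Mult V p → C • V.quadraticTwist ((-1 : ℚ) ^ (p / 2) * p) = W →
        ∀ {N : ℕ} [NeZero N] (f : CuspForm (Gamma0 N) 2), IsNewformOf V f → ∀ (ap : ℤ), cuspCoeff f p = ap →
        ∀ ϖ : ℚ, (if Even (p / 2) then (ϖ : ℝ) * V.realPeriodRat = plusPeriod f
            else (ϖ : ℝ) * V.imaginaryPeriodRat = minusPeriod f) →
          PowerSeries.coeff 1 (PowerSeries.C (ϖ : ℚ_[p]) *
              (if Even (p / 2) then padicLFunctionPlusBranchMult f (ap : ℚ_[p]) (p / 2)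
                else padicLFunctionMinusBranchMult f (ap : ℚ_[p]) (p / 2))) ≠ 0) :
    MultLower :=
  multLowerOfParts_proof h1 h2 h3 h4 hΛ
    (multSchneiderNondegeneracy_of_delbourgoDatumFact_of_classCert hFact h3 h4.1 h4.2.2 hCert)
    (multBranchPAdicGrossZagierAt_of_delbourgoDatumFact hFact h3 h4.1)

/-! ### §5 Per pair: the doors the ∀-datum (M) `p`-adic Gross–Zagier opens -/

/-- **Per pair, ANY (M) row (X3♯(M), X4(M), surjective or not), `r_an = 1`, EVERY odd `p`: the LOWER half
from the facts, p10's Λ-adic input on the twist models of THIS pair, and the bit.** `W` globally minimal,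
`PotMult W p`, `p` odd: granted hFact, `hDelM`, modularity (`hmod`, `hmodD`), GZK — IF every globally
minimal twist model `V` (`C • V^{(p*)} = W`) satisfies `QuadraticBranchLowerDivisibilityAt V p` (item 19590 at
the pair; NOT in print) and the bit holds on every twist datum, THEN `MissingLowerBoundAt W p`. The tree's
`PotMult.missingLowerBoundAt_rankOne_of_quadraticBranchLower_of_branchPAdicGrossZagierMult` with its
∀-datum binder `hGZ` DISCHARGED by §2 and `potMult_forall_branchPAdicGrossZagierMultAt_of_delbourgoDatumFact`.
No image hypothesis. GZ-H applies. Conditional; nothing booked. [cite: Delbourgo2002, Theorem (A), (B) (p. 40)]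
[cite: Disegni2017, Thm. B (§1.3.2), Rem. 1.3.2] [cite: Miller2011LMS, Def. 1.1] -/
theorem potMult_missingLowerBoundAt_rankOne_of_delbourgoDatumFact_of_quadraticBranchLower_of_multCoeffOneNeZero
    [W.IsElliptic] [W.IsGloballyMinimal]
    (hFact : delbourgoDatum_rankOne_leadingTerms) (hDelM : Delbourgo2002.mainTheorem_potMult)
    (hmod : hasEntireLFunction_rat) (hmodD : nonempty_modularParametrizationData)
    (hGZK : rank_eq_analyticRank_of_analyticRank_le_one)
    (hpm : Summit.BirchSwinnertonDyer.Rank1Residual.AdditivePotMult.PotMult W p) (hp2 : p ≠ 2) (hr : W.analyticRank = 1)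
    (hc : ∀ (V : WeierstrassCurve ℚ) [V.IsElliptic] [V.IsGloballyMinimal],
      (∃ C : VariableChange ℚ, C • V.quadraticTwist ((-1) ^ (p / 2) * p : ℚ) = W) →
        QuadraticBranchLowerDivisibilityAt V p)
    (hne : ∀ (V : WeierstrassCurve ℚ) [V.IsElliptic] [V.IsGloballyMinimal] (C : VariableChange ℚ),
      Mult V p → C • V.quadraticTwist ((-1 : ℚ) ^ (p / 2) * p) = W →
      ∀ {N : ℕ} [NeZero N] (f : CuspForm (Gamma0 N) 2), IsNewformOf V f → ∀ (ap : ℤ), cuspCoeff f p = ap →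
      ∀ ϖ : ℚ, (if Even (p / 2) then (ϖ : ℝ) * V.realPeriodRat = plusPeriod f
          else (ϖ : ℝ) * V.imaginaryPeriodRat = minusPeriod f) →
        PowerSeries.coeff 1 (PowerSeries.C (ϖ : ℚ_[p]) *
            (if Even (p / 2) then padicLFunctionPlusBranchMult f (ap : ℚ_[p]) (p / 2)
              else padicLFunctionMinusBranchMult f (ap : ℚ_[p]) (p / 2))) ≠ 0) :
    MissingLowerBoundAt W p :=
  hpm.missingLowerBoundAt_rankOne_of_quadraticBranchLower_of_branchPAdicGrossZagierMult hDelM hmod hmodD hGZK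
    hp2 hr hc fun Dh hB ↦
      ⟨potMult_forall_schneider_of_delbourgoDatumFact_of_multCoeffOneNeZero hFact hDelM hGZK hmodD hpm hp2 hr
          hne Dh hB,
        potMult_forall_branchPAdicGrossZagierMultAt_of_delbourgoDatumFact hFact hDelM hGZK hpm hp2 hr Dh hB⟩

/-- **Per pair, X4(M) ∧ surj(p), the index-`n₀` rows of Route G, `r_an = 1`, EVERY odd `p`: `BSD(E,p)`
from hFact + Kato's half + the census record at index `n₀` + the budget + the bit.** n1011-p07's capstone
`ClassX4M.bsdp_iff_forall_branchPAdicGrossZagierMultAt_of_katoHalf_of_firstUnitIndex_of_budget` reduces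
`BSD(E,p)` on such a row to "the typed (M) `p`-adic Gross–Zagier for every (B)-datum"; that right-hand side
is now SUPPLIED by hFact (`potMult_forall_branchPAdicGrossZagierMultAt_of_delbourgoDatumFact`). Inputs:
`hK` (Kato 17.4 (3), half-eigenspace reading), `hDelM`, `hmod`, `hmodD`, GZK, hFact (by name); per pair the
record `Mult[Odd]FirstUnitIndexAt W p n₀` (CERTIFICATE-EVIDENCE), `BudgetLeLambdaAt p W n₀` (a theorem when
`n₀ ≤ 1`; else a partner / EPW transfer) and the bit. GZ-H applies. Per pair; nothing booked.
[cite: Kato2004Asterisque, Thm. 17.4 (3) (p. 273)] [cite: Delbourgo2002, Theorem (A), (B) (p. 40)]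
[cite: Disegni2017, Thm. B (§1.3.2), Rem. 1.3.2] [cite: Miller2011LMS, Def. 1.1] -/
theorem ClassX4M.bsdp_rankOne_of_delbourgoDatumFact_of_katoHalf_of_firstUnitIndex_of_budget
    [W.IsElliptic] [W.IsGloballyMinimal]
    (hFact : delbourgoDatum_rankOne_leadingTerms) (hDelM : Delbourgo2002.mainTheorem_potMult)
    (hK : Wuthrich2014.kato_halfEigenCharIdeal_dvd_cyclotomicPrime_of_surjective)
    (hmod : hasEntireLFunction_rat) (hmodD : nonempty_modularParametrizationData)
    (hGZK : rank_eq_analyticRank_of_analyticRank_le_one)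
    (hX : ClassX4M W p) (hsurj : Surj W p) (hr : W.analyticRank = 1) {n₀ : ℕ}
    (hrec : (p % 4 = 1 → CensusQ6.MultFirstUnitIndexAt W p n₀) ∧ (p % 4 = 3 → CensusQ6.MultOddFirstUnitIndexAt W p n₀))
    (hbud : BudgetLeLambdaAt p W n₀)
    (hne : ∀ (V : WeierstrassCurve ℚ) [V.IsElliptic] [V.IsGloballyMinimal] (C : VariableChange ℚ),
      Mult V p → C • V.quadraticTwist ((-1 : ℚ) ^ (p / 2) * p) = W →
      ∀ {N : ℕ} [NeZero N] (f : CuspForm (Gamma0 N) 2), IsNewformOf V f → ∀ (ap : ℤ), cuspCoeff f p = ap →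
      ∀ ϖ : ℚ, (if Even (p / 2) then (ϖ : ℝ) * V.realPeriodRat = plusPeriod f
          else (ϖ : ℝ) * V.imaginaryPeriodRat = minusPeriod f) →
        PowerSeries.coeff 1 (PowerSeries.C (ϖ : ℚ_[p]) *
            (if Even (p / 2) then padicLFunctionPlusBranchMult f (ap : ℚ_[p]) (p / 2)
              else padicLFunctionMinusBranchMult f (ap : ℚ_[p]) (p / 2))) ≠ 0) :
    BSDp W p :=
  (hX.bsdp_iff_forall_branchPAdicGrossZagierMultAt_of_katoHalf_of_firstUnitIndex_of_budget hDelM hK hmod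
      hmodD hGZK hsurj hr hrec hbud hne).mpr
    (potMult_forall_branchPAdicGrossZagierMultAt_of_delbourgoDatumFact hFact hDelM hGZK hX.potMult
      hX.p_ne_two hr)

/-- **Per pair, X4(M) ∧ surj(p), record at index `1` (the unit-certified rows), `r_an = 1`: `BSD(E,p)` from
hFact + Kato's half + the index-`1` record** — no budget (`n₀ = 1 = rank`), no separate bit (the record's
unit IS the bit): `ClassX4M.bsdp_iff_forall_branchPAdicGrossZagierMultAt_of_katoHalf_of_firstUnitIndex_one`
`.mpr`. (Same rows as `TwistedBranchPAdicGrossZagierBSD.ClassX4M.bsdp_rankOne_of_delbourgoDatumFact_of_katoHalf_of_multCert`;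
recorded for the uniform index-`n₀` reading.) [cite: Kato2004Asterisque, Thm. 17.4 (3) (p. 273)]
[cite: Delbourgo2002, Theorem (A), (B) (p. 40)] [cite: Disegni2017, Thm. B (§1.3.2), Rem. 1.3.2] -/
theorem ClassX4M.bsdp_rankOne_of_delbourgoDatumFact_of_katoHalf_of_firstUnitIndex_one
    [W.IsElliptic] [W.IsGloballyMinimal]
    (hFact : delbourgoDatum_rankOne_leadingTerms) (hDelM : Delbourgo2002.mainTheorem_potMult)
    (hK : Wuthrich2014.kato_halfEigenCharIdeal_dvd_cyclotomicPrime_of_surjective)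
    (hmod : hasEntireLFunction_rat) (hmodD : nonempty_modularParametrizationData)
    (hGZK : rank_eq_analyticRank_of_analyticRank_le_one)
    (hX : ClassX4M W p) (hsurj : Surj W p) (hr : W.analyticRank = 1)
    (hrec : (p % 4 = 1 → CensusQ6.MultFirstUnitIndexAt W p 1) ∧ (p % 4 = 3 → CensusQ6.MultOddFirstUnitIndexAt W p 1)) :
    BSDp W p :=
  (hX.bsdp_iff_forall_branchPAdicGrossZagierMultAt_of_katoHalf_of_firstUnitIndex_one hDelM hK hmod hmodD
      hGZK hsurj hr hrec).mpr
    (potMult_forall_branchPAdicGrossZagierMultAt_of_delbourgoDatumFact hFact hDelM hGZK hX.potMult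
      hX.p_ne_two hr)

/-- **Per pair, X3♯(M) (reducible `E[p]`), `r_an = 1`, EVERY odd `p`: `BSD(E,p)` from hFact + Wuthrich's
half + p10's Λ-adic input on the twist models + the bit** — n1011's loop-closing iff
`ClassX3M.bsdp_iff_forall_branchPAdicGrossZagierMultAt_of_quadraticBranchLower_of_wuthrichHalf` `.mpr`, with
its rider `hSall` DISCHARGED by §2 (bit + rigidity; no Wuthrich needed for the rider) and its right-hand
side SUPPLIED by hFact. Per pair; nothing booked. [cite: Wuthrich2014, Thm. 16 (p. 397)]
[cite: Delbourgo2002, Theorem (A), (B) (p. 40)] [cite: Disegni2017, Thm. B (§1.3.2), Rem. 1.3.2] [cite: Miller2011LMS, Def. 1.1] -/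
theorem ClassX3M.bsdp_rankOne_of_delbourgoDatumFact_of_wuthrichHalf_of_quadraticBranchLower_of_multCoeffOneNeZero
    [W.IsElliptic] [W.IsGloballyMinimal]
    (hFact : delbourgoDatum_rankOne_leadingTerms) (hDelM : Delbourgo2002.mainTheorem_potMult)
    (hW16 : Wuthrich2014.thm16_halfEigenCharIdeal_dvd_cyclotomicPrime)
    (hmod : hasEntireLFunction_rat) (hmodD : nonempty_modularParametrizationData)
    (hGZK : rank_eq_analyticRank_of_analyticRank_le_one) (hX : ClassX3M W p) (hr : W.analyticRank = 1)
    (hc : ∀ (V : WeierstrassCurve ℚ) [V.IsElliptic] [V.IsGloballyMinimal],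
      (∃ C : VariableChange ℚ, C • V.quadraticTwist ((-1) ^ (p / 2) * p : ℚ) = W) →
        QuadraticBranchLowerDivisibilityAt V p)
    (hne : ∀ (V : WeierstrassCurve ℚ) [V.IsElliptic] [V.IsGloballyMinimal] (C : VariableChange ℚ),
      Mult V p → C • V.quadraticTwist ((-1 : ℚ) ^ (p / 2) * p) = W →
      ∀ {N : ℕ} [NeZero N] (f : CuspForm (Gamma0 N) 2), IsNewformOf V f → ∀ (ap : ℤ), cuspCoeff f p = ap →
      ∀ ϖ : ℚ, (if Even (p / 2) then (ϖ : ℝ) * V.realPeriodRat = plusPeriod f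
          else (ϖ : ℝ) * V.imaginaryPeriodRat = minusPeriod f) →
        PowerSeries.coeff 1 (PowerSeries.C (ϖ : ℚ_[p]) *
            (if Even (p / 2) then padicLFunctionPlusBranchMult f (ap : ℚ_[p]) (p / 2)
              else padicLFunctionMinusBranchMult f (ap : ℚ_[p]) (p / 2))) ≠ 0) :
    BSDp W p :=
  (hX.bsdp_iff_forall_branchPAdicGrossZagierMultAt_of_quadraticBranchLower_of_wuthrichHalf hDelM hW16 hmod
      hmodD hGZK hr hc
      (potMult_forall_schneider_of_delbourgoDatumFact_of_multCoeffOneNeZero hFact hDelM hGZK hmodD hX.potMult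
        hX.p_ne_two hr hne)).mpr
    (potMult_forall_branchPAdicGrossZagierMultAt_of_delbourgoDatumFact hFact hDelM hGZK hX.potMult
      hX.p_ne_two hr)

end Summit.BirchSwinnertonDyer.BirchSwinnertonDyer.Theorems.AdditiveBranchIMCMultLower

end
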